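import Literature.MathematicalPhysics.QuantumFieldTheory.LatticeDiamagneticInequality
import Literature.MathematicalPhysics.QuantumFieldTheory.King1986.EffectiveLaplacianSymbol
import HarnessLib
/-!
# BalabanUVNodes ∕ N15 — THE KING-MODEL RUNG (PART Ͱ-a): THE COVARIANT FINE OPERATOR `−cΔ_U + m²` ON KING's TORUS AT AN ARBITRARY LINK FIELD `U` — the tree's minimally
# coupled operator of a KING HOPPING DATUM; `= lapF ⊗ₖ 1` at `U ≡ 1`; Hermitian, positive definite, invertible for unitary `U`; the stencil; gauge covariance
# (Track A, DAG node N15 = NE2; FAN-OUT v1.1 §N15 s3 «KING-MODEL RUNG … + what the curved case adds»; count-neutral)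
HONEST FRAMING.  Count-neutral (cell `pub-ymgap`, seat `pub-ymgap-dag-n15-e` g42; `--supports stmt-QuantumFields-27247 --as helper` = K3ᴬ, KEY MAP v3).  One finite torus at fixed
spacing; King's `A = 0` model is the COMPARISON object of PART Ͱ; nothing of Bałaban's (3.42) asserted; nothing continuum ∕ ℝ⁴ ∕ OS ∕ Clay; NOT a node discharge (N15 of record untouched).
THE OBJECT.  King's fine operator `c(−Δ) + m²` on `T = Π_μℤ∕K_μ` ([King1986] (4.4) p.670; the tree's `King1986.Torus.lapF K c m²` of parts Ε∕Ϟ) is the `U ≡ 1` member of the family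
`M_U = −cΔ_U + m²` minimally coupled to a lattice gauge field `U : (x,μ) ↦ U(x,μ)` (an `n × n` matrix on the bond `x → x+e_μ`) — [Balaban1985BackgroundPropagators] (3.3) p.391
`(D_U f)(b) = η⁻¹(U(b)f(b₊) − f(b₋))`, (3.23) p.394 `Δ^η_U = D*_U D_U`; King's own `U(1)` Higgs model [King1986] (1.1)–(1.3) p.650 couples its scalar to `A` through this difference:
`(M_U v)(x) = (m² + 2(d+1)c)v(x) − cΣ_μ(U(x,μ)v(x+e_μ) + U(x−e_μ,μ)^*v(x−e_μ))`, `v : T → 𝕜ⁿ` (`𝕜 = ℝ` or `ℂ`).  TYPED HERE as the tree's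
`LatticeDiamagneticInequality.Hopping.coupling` ([BrydgesFrohlichSeiler1979] as invoked at [Balaban1982Higgs2] (3.38) p.591; Mathlib-only, PROVED) of `kingHopping K c m²` (sites `T`,
bonds `T × Fin(d+1)`, `src (x,μ) = x`, `tgt (x,μ) = x+e_μ`, bond weight `c`, site weight `m²+2(d+1)c`), so that file's theorems apply BY NAME.  PROVED: §1 `kingHopping_rowSum`
(`= 2(d+1)c`), ★ `kingHopping_strictDom` (`c ≥ 0`, `m² > 0`); §2 `placed_mulVec_apply`, `covLapF_eq`, ★ `covLapF_apply` (entries), ★★ **`covLapF_mulVec_apply`** (THE STENCIL above),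
★★ **`covLapF_free_eq_kronecker`** (`M_1 = lapF ⊗ₖ 1ₙ` EXACTLY, degenerate periods included), `blk_covLapF`; §3 ★ `isHermitian_covLapF`, ★★ **`posDef_covLapF`** (unitary `U`),
`isUnit_covLapF`, `det_covLapF_ne_zero`, ★ `covLapF_mul_inv`∕`covLapF_inv_mul` (the covariant fine covariance `G_U = M_U⁻¹`), `posDef_covLapF_inv`, `isHermitian_covLapF_inv`,
★★ **`det_covLapF_free`** (`det M_1 = (det lapF)^{|n|}`), `lapF_det_isUnit` (every torus), ★★ **`covLapF_free_inv_eq_kronecker`** (`G_1 = lapF⁻¹ ⊗ₖ 1ₙ`), `covLapF_free_inv_apply`,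
`ext_of_blk`; §4 GAUGE COVARIANCE ([Balaban1985BackgroundPropagators] p.398 l.1–2 «invariant with respect to gauge transformations of U»): `kingGaugeMat g = ⊕_x g(x)`,
`kingGaugeAct g U (x,μ) = g(x)U(x,μ)g(x+e_μ)^*`, `blk_kingGaugeMat_conj`, `kingGaugeMat_conjTranspose_mul_self`∕`_mul_conjTranspose_self`∕`_mem_unitaryGroup`, `kingGaugeAct_mem_unitaryGroup`,
★★ **`covLapF_kingGaugeAct`** (`M_{U^g} = D_gM_UD_g^*`), ★★ **`covLapF_kingGaugeAct_inv`** (`G_{U^g} = D_gG_UD_g^*`), ★ `blk_covLapF_kingGaugeAct_inv`, ★ `det_covLapF_kingGaugeAct`.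
WHAT THE CURVED CASE ADDS ∕ LOCATED (not claimed).  Parts Ͱ-b∕c prove from this file that King's `A = 0` covariance MAJORISES `G_U` blockwise at every unitary `U` (Kato's inequality)
and that `det M_U ≥ det M_1` (diamagnetism).  Neither extends to King's FULL propagator `G_k(U) = (−Δ_U + m² + aQ_U^*Q_U)⁻¹`: the averaging penalty has same-block off-diagonal
entries `+aL^{−2(d+1)}·(unitary)` whose Kato shadow is the block-clique graph Laplacian of weight `aL^{−2(d+1)}` plus the mass `m² − aL^{−(d+1)}(1 − 2L^{−(d+1)})`, NEGATIVE for small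
`m²` (cf. the tree's `B9Eq323KatoDomination` HONEST SCOPE «the averaging penalty of (3.24) is NOT of Kato form»).  PRIOR TREE ART (by name): `LatticeDiamagneticInequality` (`Hopping`,
`coupling`, `hop`, `placed`, `blk`, `free`, `isHermitian_coupling`, `posDef_coupling`, `det_coupling_pos`), `King1986.EffectiveLaplacianSymbol` (`lapF`), `B5Prop11Plancherel` (`Tor`,
`unitVec`), Mathlib (`kroneckerMap`, `det_kronecker`, `inv_kronecker`, `unitaryGroup`).  Dedup (rg at filing): basename 0 files; `kingHopping|covLapF|kingGaugeMat|kingGaugeAct|ext_of_blk`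
0 tree files.  Locators: [King1986] (4.4) p.670, (1.1)–(1.3) p.650; [Balaban1985BackgroundPropagators] (3.3) p.391, (3.23) p.394, p.398 l.1–2; [Balaban1982Higgs2] (3.38) p.591.  0 `sorry`.
-/

noncomputable section
open scoped BigOperators ComplexConjugate ComplexOrder Kronecker
open Finset Matrix

namespace Summit.QuantumFields.YangMills.BalabanUVNodes.N15KingModelRung.Covariant

open Literature.MathematicalPhysics.QuantumFieldTheory.LatticeDiamagneticInequality (Hopping blk placed)
open Literature.MathematicalPhysics.QuantumFieldTheory.Balaban1983to89.B5Prop11Plancherel (Tor unitVec)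
open Literature.MathematicalPhysics.QuantumFieldTheory.King1986.Torus (lapF)

variable {d : ℕ} (K : Fin (d + 1) → ℕ)

/-! ## §1 The King hopping datum on the torus -/

section Datum

/-- THE KING HOPPING DATUM of `c(−Δ) + m²` on the torus `Π_μ ℤ∕K_μ`: bonds `(x, μ)` from `x` to `x + e_μ`, bond weight `c`, site weight `m² + 2(d+1)c`
(King's (4.4) `(m² + 2dη⁻²)δ − η⁻²Σ_{±μ}` in `d+1` dimensions, `c = η⁻²`). [cite: King1986, (4.4) p.670; Balaban1985BackgroundPropagators, (3.23) p.394] -/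
def kingHopping (c m2 : ℝ) : Hopping (Tor K) (Tor K × Fin (d + 1)) where
  src := fun b => b.1
  tgt := fun b => b.1 + unitVec K b.2
  w := fun _ => c
  c := fun _ => m2 + 2 * ((d : ℝ) + 1) * c

variable [hK : ∀ μ, NeZero (K μ)]

/-- The total hopping weight at every site is `2(d+1)c` (each of the `d+1` outgoing and `d+1` incoming bonds carries `c`). [cite: King1986, (4.4) p.670] -/
theorem kingHopping_rowSum (c m2 : ℝ) (x : Tor K) : (kingHopping K c m2).rowSum x = 2 * ((d : ℝ) + 1) * c := by
  unfold Hopping.rowSum kingHopping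
  simp only
  rw [Finset.sum_add_distrib, Fintype.sum_prod_type, Fintype.sum_prod_type]
  have h1 : ∀ μ : Fin (d + 1), (∑ y : Tor K, if y = x then c else 0) = c := fun μ => by
    rw [Finset.sum_ite_eq' Finset.univ x, if_pos (Finset.mem_univ _)]
  have h2 : ∀ μ : Fin (d + 1), (∑ y : Tor K, if y + unitVec K μ = x then c else 0) = c := fun μ => by
    have : ∀ y : Tor K, (y + unitVec K μ = x) ↔ (y = x - unitVec K μ) := fun y => eq_sub_iff_add_eq.symm
    simp only [this]
    rw [Finset.sum_ite_eq' Finset.univ (x - unitVec K μ), if_pos (Finset.mem_univ _)]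
  rw [Finset.sum_comm, Finset.sum_congr rfl fun μ _ => h1 μ, Finset.sum_comm, Finset.sum_congr rfl fun μ _ => h2 μ,
    Finset.sum_const, Finset.card_univ, Fintype.card_fin]
  simp only [nsmul_eq_mul]
  push_cast
  ring
/-- ★ STRICT DIAGONAL DOMINANCE of the King datum: `c ≥ 0` and `m² > 0` give `2(d+1)c < m² + 2(d+1)c` at every site — the hypothesis of every theorem of
`LatticeDiamagneticInequality`. [cite: King1986, (4.4) p.670] -/
theorem kingHopping_strictDom {c m2 : ℝ} (hc : 0 ≤ c) (hm : 0 < m2) : (kingHopping K c m2).StrictDom where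
  w_nonneg := fun _ => hc
  dom := fun x => by
    rw [kingHopping_rowSum]
    show 2 * ((d : ℝ) + 1) * c < m2 + 2 * ((d : ℝ) + 1) * c
    linarith

end Datum

/-! ## §2 The covariant operator, its entries, its stencil, and the free case -/

section Operator

variable {𝕜 : Type*} [RCLike 𝕜] {n : Type*} [Fintype n] [DecidableEq n]

omit [DecidableEq n] in
/-- A placed block acts on the `b`-component only: `(E_{ab}(A)v)(p) = [a = p.1]·(A v_b)_{p.2}`. [folklore] -/
theorem placed_mulVec_apply {ι : Type*} [Fintype ι] [DecidableEq ι] (a b : ι) (A : Matrix n n 𝕜) (v : ι × n → 𝕜) (p : ι × n) :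
    (placed a b A *ᵥ v) p = if a = p.1 then (A *ᵥ fun j => v (b, j)) p.2 else 0 := by
  simp only [Matrix.mulVec, dotProduct, placed, Matrix.of_apply]
  rw [Fintype.sum_prod_type]
  by_cases h : a = p.1
  · simp only [h, true_and, if_true]
    rw [Finset.sum_eq_single b (fun z _ hz => by simp [Ne.symm hz]) (fun hb => absurd (Finset.mem_univ _) hb)]
    simp only [if_true]
  · simp [h]

variable [hK : ∀ μ, NeZero (K μ)]

/-- THE COVARIANT FINE OPERATOR `M_U = −cΔ_U + m²` on `v : Π_μℤ∕K_μ → 𝕜ⁿ` at the link field `U : (x,μ) ↦ U(x,μ)` (an `n × n` matrix on the bond `x → x+e_μ`; unitary in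
the applications): the tree's minimally coupled operator of the King hopping datum. [cite: Balaban1985BackgroundPropagators, (3.23) p.394; King1986, (4.4) p.670] -/
def covLapF (c m2 : ℝ) (U : Tor K × Fin (d + 1) → Matrix n n 𝕜) : Matrix (Tor K × n) (Tor K × n) 𝕜 :=
  (kingHopping K c m2).coupling U
omit [Fintype n] in
/-- `M_U = diag(m²+2(d+1)c) − T_U` (unfolding of the tree's `coupling`). [cite: Balaban1985BackgroundPropagators, (3.23) p.394] -/
theorem covLapF_eq (c m2 : ℝ) (U : Tor K × Fin (d + 1) → Matrix n n 𝕜) :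
    covLapF K c m2 U = diagonal (fun _ : Tor K × n => ((m2 + 2 * ((d : ℝ) + 1) * c : ℝ) : 𝕜)) - (kingHopping K c m2).hop U := rfl
omit [Fintype n] in
/-- ★ THE ENTRIES of `M_U`: `M_U((x,i),(y,j)) = (m²+2(d+1)c)[x=y][i=j] − cΣ_μ([y = x+e_μ]U(x,μ)_{ij} + [y = x−e_μ](U(x−e_μ,μ)^*)_{ij})`.
[cite: Balaban1985BackgroundPropagators, (3.23) p.394; King1986, (4.4) p.670] -/
theorem covLapF_apply (c m2 : ℝ) (U : Tor K × Fin (d + 1) → Matrix n n 𝕜) (x y : Tor K) (i j : n) :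
    covLapF K c m2 U (x, i) (y, j)
      = (if x = y ∧ i = j then ((m2 + 2 * ((d : ℝ) + 1) * c : ℝ) : 𝕜) else 0)
        - (c : 𝕜) * ∑ μ, ((if y = x + unitVec K μ then U (x, μ) i j else 0)
            + (if y = x - unitVec K μ then (U (x - unitVec K μ, μ))ᴴ i j else 0)) := by
  rw [covLapF_eq, Matrix.sub_apply, diagonal_apply]
  congr 1
  · simp only [Prod.mk.injEq]
  · simp only [Hopping.hop, kingHopping, Matrix.sum_apply, Matrix.smul_apply, Matrix.add_apply, placed, Matrix.of_apply, smul_eq_mul]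
    rw [← Finset.mul_sum, Fintype.sum_prod_type, Finset.sum_comm]
    congr 1
    refine Finset.sum_congr rfl fun μ _ => ?_
    rw [Finset.sum_add_distrib]
    congr 1
    · rw [Finset.sum_eq_single x (fun z _ hz => by simp [hz]) (fun hx => absurd (Finset.mem_univ _) hx)]
      simp only [true_and]
      exact if_congr eq_comm rfl rfl
    · rw [Finset.sum_eq_single (x - unitVec K μ) (fun z _ hz => ?_) (fun hx => absurd (Finset.mem_univ _) hx)]
      · simp only [sub_add_cancel, true_and]
        exact if_congr eq_comm rfl rfl
      · have : ¬ (z + unitVec K μ = x) := fun h => hz (eq_sub_of_add_eq h)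
        simp [this]
/-- ★★ **THE STENCIL**: `(M_U v)(x,i) = (m²+2(d+1)c)v(x,i) − cΣ_μ((U(x,μ)v(x+e_μ))_i + (U(x−e_μ,μ)^* v(x−e_μ))_i)` — the covariant nearest-neighbour operator
`−cΔ_U + m²` with forward transporter `U(x,μ)` on `x → x+e_μ` and backward transporter `U(x−e_μ,μ)^*` on `x → x−e_μ`.
[cite: Balaban1985BackgroundPropagators, (3.3) p.391, (3.23) p.394; King1986, (4.4) p.670] -/
theorem covLapF_mulVec_apply (c m2 : ℝ) (U : Tor K × Fin (d + 1) → Matrix n n 𝕜) (v : Tor K × n → 𝕜) (x : Tor K) (i : n) :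
    (covLapF K c m2 U *ᵥ v) (x, i)
      = ((m2 + 2 * ((d : ℝ) + 1) * c : ℝ) : 𝕜) * v (x, i)
        - (c : 𝕜) * ∑ μ, ((U (x, μ) *ᵥ fun j => v (x + unitVec K μ, j)) i
            + ((U (x - unitVec K μ, μ))ᴴ *ᵥ fun j => v (x - unitVec K μ, j)) i) := by
  rw [covLapF_eq, sub_mulVec, Pi.sub_apply, mulVec_diagonal]
  congr 1
  simp only [Hopping.hop, kingHopping, Matrix.sum_mulVec, Matrix.smul_mulVec, Matrix.add_mulVec, Finset.sum_apply, Pi.smul_apply,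
    Pi.add_apply, placed_mulVec_apply, smul_eq_mul]
  rw [← Finset.mul_sum, Fintype.sum_prod_type, Finset.sum_comm]
  congr 1
  refine Finset.sum_congr rfl fun μ _ => ?_
  rw [Finset.sum_add_distrib]
  dsimp only
  congr 1
  · rw [Finset.sum_ite_eq' Finset.univ x, if_pos (Finset.mem_univ _)]
  · have hiff : ∀ z : Tor K, (z + unitVec K μ = x) ↔ (z = x - unitVec K μ) := fun z => eq_sub_iff_add_eq.symm
    simp only [hiff]
    rw [Finset.sum_ite_eq' Finset.univ (x - unitVec K μ), if_pos (Finset.mem_univ _)]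
omit [Fintype n] in
/-- ★★ **THE FREE CASE IS KING's OPERATOR, COMPONENTWISE**: at `U ≡ 1`, `M_1 = lapF K c m² ⊗ₖ 1ₙ` EXACTLY (every period vector, degenerate periods included).
[cite: King1986, (4.4) p.670] -/
theorem covLapF_free_eq_kronecker (c m2 : ℝ) :
    covLapF K c m2 (Hopping.free : Tor K × Fin (d + 1) → Matrix n n 𝕜)
      = (lapF K c m2).map ((↑) : ℝ → 𝕜) ⊗ₖ (1 : Matrix n n 𝕜) := by
  ext ⟨x, i⟩ ⟨y, j⟩
  rw [covLapF_apply, kroneckerMap_apply, Matrix.map_apply]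
  simp only [Hopping.free, conjTranspose_one, Matrix.one_apply, lapF]
  by_cases hij : i = j
  · subst hij
    simp only [and_true, if_true, mul_one]
    push_cast
    congr 1
    · by_cases hxy : x = y
      · rw [if_pos hxy, if_pos hxy.symm]; simp
      · rw [if_neg hxy, if_neg (Ne.symm hxy)]; simp
    · congr 1
      refine Finset.sum_congr rfl fun μ _ => ?_
      congr 1 <;> split_ifs <;> simp
  · simp only [hij, and_false, if_false, mul_zero, ite_self, add_zero, Finset.sum_const_zero, sub_self]
omit [Fintype n] in
/-- The `n × n` BLOCKS of `M_U`: `(M_U)_{xy} = (m²+2(d+1)c)[x=y]·1 − cΣ_μ([y=x+e_μ]U(x,μ) + [y=x−e_μ]U(x−e_μ,μ)^*)`. [cite: Balaban1985BackgroundPropagators, (3.23) p.394] -/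
theorem blk_covLapF (c m2 : ℝ) (U : Tor K × Fin (d + 1) → Matrix n n 𝕜) (x y : Tor K) :
    blk (covLapF K c m2 U) x y
      = (if x = y then (((m2 + 2 * ((d : ℝ) + 1) * c : ℝ) : 𝕜) • (1 : Matrix n n 𝕜)) else 0)
        - (c : 𝕜) • ∑ μ, ((if y = x + unitVec K μ then U (x, μ) else 0)
            + (if y = x - unitVec K μ then (U (x - unitVec K μ, μ))ᴴ else 0)) := by
  ext i j
  simp only [blk, Matrix.of_apply]
  rw [covLapF_apply, Matrix.sub_apply]
  congr 1
  · by_cases hxy : x = y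
    · simp only [hxy, true_and, if_true, Matrix.smul_apply, Matrix.one_apply, smul_eq_mul, mul_ite, mul_one, mul_zero]
    · simp only [hxy, false_and, if_false, Matrix.zero_apply]
  · rw [Matrix.smul_apply, smul_eq_mul, Matrix.sum_apply]
    congr 1
    refine Finset.sum_congr rfl fun μ _ => ?_
    rw [Matrix.add_apply]
    congr 1 <;> split_ifs <;> rfl

end Operator

/-! ## §3 Hermitian, positive definite, invertible; the free determinant and covariance -/

section Structure

variable {𝕜 : Type*} [RCLike 𝕜] {n : Type*} [Fintype n] [DecidableEq n]
variable [hK : ∀ μ, NeZero (K μ)]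

omit [Fintype n] in
/-- ★ `M_U` is Hermitian for every link field (no unitarity needed). [cite: Balaban1985BackgroundPropagators, (3.23) p.394] -/
theorem isHermitian_covLapF (c m2 : ℝ) (U : Tor K × Fin (d + 1) → Matrix n n 𝕜) : (covLapF K c m2 U).IsHermitian :=
  (kingHopping K c m2).isHermitian_coupling U
/-- ★★ **`M_U` IS POSITIVE DEFINITE** for every unitary link field, `c ≥ 0`, `m² > 0` (the tree's `posDef_coupling` under the King datum's strict dominance).
[cite: Balaban1982Higgs2, (3.38) p.591; Balaban1985BackgroundPropagators, (3.23) p.394] -/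
theorem posDef_covLapF {c m2 : ℝ} (hc : 0 ≤ c) (hm : 0 < m2) {U : Tor K × Fin (d + 1) → Matrix n n 𝕜}
    (hU : ∀ b, U b ∈ Matrix.unitaryGroup n 𝕜) : (covLapF K c m2 U).PosDef :=
  (kingHopping K c m2).posDef_coupling (kingHopping_strictDom K hc hm) hU
/-- `M_U` is invertible (unitary `U`, `c ≥ 0`, `m² > 0`). [cite: Balaban1985BackgroundPropagators, (3.23) p.394] -/
theorem isUnit_covLapF {c m2 : ℝ} (hc : 0 ≤ c) (hm : 0 < m2) {U : Tor K × Fin (d + 1) → Matrix n n 𝕜}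
    (hU : ∀ b, U b ∈ Matrix.unitaryGroup n 𝕜) : IsUnit (covLapF K c m2 U) :=
  (posDef_covLapF K hc hm hU).isUnit
/-- `det M_U ≠ 0` (indeed `> 0`). [cite: Balaban1982Higgs2, (3.38) p.591] -/
theorem det_covLapF_ne_zero {c m2 : ℝ} (hc : 0 ≤ c) (hm : 0 < m2) {U : Tor K × Fin (d + 1) → Matrix n n 𝕜}
    (hU : ∀ b, U b ∈ Matrix.unitaryGroup n 𝕜) : (covLapF K c m2 U).det ≠ 0 :=
  ((kingHopping K c m2).det_coupling_pos (kingHopping_strictDom K hc hm) hU).ne'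
/-- `IsUnit (det M_U)`. [folklore] -/
theorem isUnit_det_covLapF {c m2 : ℝ} (hc : 0 ≤ c) (hm : 0 < m2) {U : Tor K × Fin (d + 1) → Matrix n n 𝕜}
    (hU : ∀ b, U b ∈ Matrix.unitaryGroup n 𝕜) : IsUnit (covLapF K c m2 U).det :=
  (Matrix.isUnit_iff_isUnit_det _).mp (isUnit_covLapF K hc hm hU)
/-- ★ THE COVARIANT FINE COVARIANCE `G_U = M_U⁻¹` is a right inverse: `M_U G_U = 1`. [cite: Balaban1985BackgroundPropagators, (3.23) p.394] -/
theorem covLapF_mul_inv {c m2 : ℝ} (hc : 0 ≤ c) (hm : 0 < m2) {U : Tor K × Fin (d + 1) → Matrix n n 𝕜}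
    (hU : ∀ b, U b ∈ Matrix.unitaryGroup n 𝕜) : covLapF K c m2 U * (covLapF K c m2 U)⁻¹ = 1 :=
  Matrix.mul_nonsing_inv _ (isUnit_det_covLapF K hc hm hU)
/-- … and a left inverse: `G_U M_U = 1`. [cite: Balaban1985BackgroundPropagators, (3.23) p.394] -/
theorem covLapF_inv_mul {c m2 : ℝ} (hc : 0 ≤ c) (hm : 0 < m2) {U : Tor K × Fin (d + 1) → Matrix n n 𝕜}
    (hU : ∀ b, U b ∈ Matrix.unitaryGroup n 𝕜) : (covLapF K c m2 U)⁻¹ * covLapF K c m2 U = 1 :=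
  Matrix.nonsing_inv_mul _ (isUnit_det_covLapF K hc hm hU)
/-- `G_U` is positive definite. [folklore] -/
theorem posDef_covLapF_inv {c m2 : ℝ} (hc : 0 ≤ c) (hm : 0 < m2) {U : Tor K × Fin (d + 1) → Matrix n n 𝕜}
    (hU : ∀ b, U b ∈ Matrix.unitaryGroup n 𝕜) : (covLapF K c m2 U)⁻¹.PosDef :=
  (posDef_covLapF K hc hm hU).inv
/-- ★★ **THE FREE DETERMINANT**: `det M_1 = (det(c(−Δ)+m²))^{|n|}` — the free `n`-component Gaussian normalisation is the `n`-th power of King's (PART Ε-k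
`det_lapF_eq_prod_lapSym`). [cite: King1986, (3.89) p.668, (4.4) p.670] -/
theorem det_covLapF_free (c m2 : ℝ) :
    (covLapF K c m2 (Hopping.free : Tor K × Fin (d + 1) → Matrix n n 𝕜)).det = (((lapF K c m2).det : ℝ) : 𝕜) ^ Fintype.card n := by
  rw [covLapF_free_eq_kronecker, det_kronecker, det_one, one_pow, mul_one]
  have h := RingHom.map_det (algebraMap ℝ 𝕜) (lapF K c m2)
  rw [RCLike.algebraMap_eq_ofReal] at h; exact congrArg (· ^ Fintype.card n) h.symm
omit hK in
/-- The free link field is unitary. [folklore] -/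
theorem free_mem_unitaryGroup (b : Tor K × Fin (d + 1)) : (Hopping.free : Tor K × Fin (d + 1) → Matrix n n 𝕜) b ∈ Matrix.unitaryGroup n 𝕜 :=
  Submonoid.one_mem _
/-- King's `c(−Δ)+m²` has invertible determinant on EVERY torus (`c ≥ 0`, `m² > 0`) — the one-component free case of `det_covLapF_ne_zero`. [cite: King1986, (4.4) p.670] -/
theorem lapF_det_isUnit {c m2 : ℝ} (hc : 0 ≤ c) (hm : 0 < m2) : IsUnit (lapF K c m2).det := by
  have h := det_covLapF_ne_zero K (𝕜 := ℝ) (n := Unit) hc hm (free_mem_unitaryGroup K (𝕜 := ℝ) (n := Unit))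
  rw [det_covLapF_free, Fintype.card_unit, pow_one] at h
  exact isUnit_iff_ne_zero.mpr h
/-- ★★ **THE FREE COVARIANCE IS KING's, COMPONENTWISE**: `G_1 = (c(−Δ)+m²)⁻¹ ⊗ₖ 1ₙ` (`c ≥ 0`, `m² > 0`). [cite: King1986, (4.4) p.670] -/
theorem covLapF_free_inv_eq_kronecker {c m2 : ℝ} (hc : 0 ≤ c) (hm : 0 < m2) :
    (covLapF K c m2 (Hopping.free : Tor K × Fin (d + 1) → Matrix n n 𝕜))⁻¹
      = (lapF K c m2)⁻¹.map ((↑) : ℝ → 𝕜) ⊗ₖ (1 : Matrix n n 𝕜) := by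
  refine Matrix.inv_eq_left_inv ?_
  rw [covLapF_free_eq_kronecker, ← mul_kronecker_mul, Matrix.mul_one, ← RCLike.algebraMap_eq_ofReal, ← Matrix.map_mul,
    Matrix.nonsing_inv_mul _ (lapF_det_isUnit K hc hm), Matrix.map_one _ (map_zero _) (map_one _), one_kronecker_one]
/-- Entries of the free covariance: `G_1((x,i),(y,j)) = (c(−Δ)+m²)⁻¹(x,y)·[i=j]`. [cite: King1986, (4.4) p.670] -/
theorem covLapF_free_inv_apply {c m2 : ℝ} (hc : 0 ≤ c) (hm : 0 < m2) (x y : Tor K) (i j : n) :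
    (covLapF K c m2 (Hopping.free : Tor K × Fin (d + 1) → Matrix n n 𝕜))⁻¹ (x, i) (y, j)
      = (((lapF K c m2)⁻¹ x y : ℝ) : 𝕜) * (if i = j then 1 else 0) := by
  rw [covLapF_free_inv_eq_kronecker K hc hm, kroneckerMap_apply, Matrix.map_apply, Matrix.one_apply]

end Structure

/-- Two matrices on `T × n` are equal iff all their `n × n` blocks are. [folklore] -/
theorem ext_of_blk {R : Type*} {n : Type*} {M N : Matrix (Tor K × n) (Tor K × n) R} (h : ∀ x y, blk M x y = blk N x y) : M = N := by
  ext ⟨x, i⟩ ⟨y, j⟩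
  have := congr_fun (congr_fun (h x y) i) j
  simpa only [blk, Matrix.of_apply] using this

/-! ## §4 Gauge covariance -/

section Gauge

variable {𝕜 : Type*} [RCLike 𝕜] {n : Type*} [Fintype n] [DecidableEq n]

/-- The GAUGE TRANSFORMATION MATRIX `D_g = ⊕_x g(x)` of a site field of `n × n` matrices `g` (block diagonal on `T × n`). [cite: Balaban1985BackgroundPropagators, p.398 l.1–2] -/
def kingGaugeMat (g : Tor K → Matrix n n 𝕜) : Matrix (Tor K × n) (Tor K × n) 𝕜 :=
  fun p q => if p.1 = q.1 then g p.1 p.2 q.2 else 0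
/-- The GAUGE ACTION on link fields: `U^g(x,μ) = g(x)·U(x,μ)·g(x+e_μ)^*`. [cite: Balaban1985BackgroundPropagators, p.398 l.1–2] -/
def kingGaugeAct (g : Tor K → Matrix n n 𝕜) (U : Tor K × Fin (d + 1) → Matrix n n 𝕜) : Tor K × Fin (d + 1) → Matrix n n 𝕜 :=
  fun b => g b.1 * U b * (g (b.1 + unitVec K b.2))ᴴ

variable [hK : ∀ μ, NeZero (K μ)]

omit [DecidableEq n] in
/-- Blocks of a gauge conjugate: `(D_g M D_g^*)_{xy} = g(x)·M_{xy}·g(y)^*`. [folklore] -/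
theorem blk_kingGaugeMat_conj (g : Tor K → Matrix n n 𝕜) (M : Matrix (Tor K × n) (Tor K × n) 𝕜) (x y : Tor K) :
    blk (kingGaugeMat K g * M * (kingGaugeMat K g)ᴴ) x y = g x * blk M x y * (g y)ᴴ := by
  classical
  ext i j
  simp only [blk, Matrix.of_apply, Matrix.mul_apply, conjTranspose_apply]
  simp only [kingGaugeMat]
  rw [Fintype.sum_prod_type, Finset.sum_eq_single y (fun z _ hz => by simp [Ne.symm hz]) (fun h => absurd (Finset.mem_univ _) h)]
  simp only [if_true]
  refine Finset.sum_congr rfl fun l _ => ?_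
  congr 1
  rw [Fintype.sum_prod_type, Finset.sum_eq_single x (fun z _ hz => by simp [Ne.symm hz]) (fun h => absurd (Finset.mem_univ _) h)]
  simp only [if_true]
/-- `D_g^* D_g = 1` for a unitary-valued gauge field. [folklore] -/
theorem kingGaugeMat_conjTranspose_mul_self {g : Tor K → Matrix n n 𝕜} (hg : ∀ x, g x ∈ Matrix.unitaryGroup n 𝕜) :
    (kingGaugeMat K g)ᴴ * kingGaugeMat K g = 1 := by
  ext ⟨x, i⟩ ⟨y, j⟩
  simp only [Matrix.mul_apply, conjTranspose_apply, kingGaugeMat, Matrix.one_apply, Prod.mk.injEq]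
  rw [Fintype.sum_prod_type]
  by_cases hxy : x = y
  · subst hxy
    rw [Finset.sum_eq_single x (fun z _ hz => by simp [hz]) (fun h => absurd (Finset.mem_univ _) h)]
    simp only [if_true, true_and]
    have h1 : star (g x) * g x = 1 := Matrix.mem_unitaryGroup_iff'.mp (hg x)
    have := congr_fun (congr_fun h1 i) j
    rw [Matrix.mul_apply, Matrix.one_apply] at this
    simpa only [star_eq_conjTranspose, conjTranspose_apply] using this
  · simp only [hxy, false_and, if_false]
    refine Finset.sum_eq_zero fun z _ => Finset.sum_eq_zero fun k _ => ?_
    by_cases hz : z = x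
    · subst hz; simp [hxy]
    · simp [hz]
/-- `D_g D_g^* = 1` for a unitary-valued gauge field. [folklore] -/
theorem kingGaugeMat_mul_conjTranspose_self {g : Tor K → Matrix n n 𝕜} (hg : ∀ x, g x ∈ Matrix.unitaryGroup n 𝕜) :
    kingGaugeMat K g * (kingGaugeMat K g)ᴴ = 1 :=
  mul_eq_one_comm.mp (kingGaugeMat_conjTranspose_mul_self K hg)
/-- `D_g` is unitary. [folklore] -/
theorem kingGaugeMat_mem_unitaryGroup {g : Tor K → Matrix n n 𝕜} (hg : ∀ x, g x ∈ Matrix.unitaryGroup n 𝕜) :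
    kingGaugeMat K g ∈ Matrix.unitaryGroup (Tor K × n) 𝕜 :=
  Matrix.mem_unitaryGroup_iff'.mpr (by simpa only [star_eq_conjTranspose] using kingGaugeMat_conjTranspose_mul_self K hg)
omit hK in
/-- The gauge action preserves unitarity of the link field. [folklore] -/
theorem kingGaugeAct_mem_unitaryGroup {g : Tor K → Matrix n n 𝕜} (hg : ∀ x, g x ∈ Matrix.unitaryGroup n 𝕜)
    {U : Tor K × Fin (d + 1) → Matrix n n 𝕜} (hU : ∀ b, U b ∈ Matrix.unitaryGroup n 𝕜) (b : Tor K × Fin (d + 1)) :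
    kingGaugeAct K g U b ∈ Matrix.unitaryGroup n 𝕜 := by
  unfold kingGaugeAct
  refine Submonoid.mul_mem _ (Submonoid.mul_mem _ (hg _) (hU b)) ?_
  simpa only [star_eq_conjTranspose] using Unitary.star_mem (hg _)
/-- ★★ **GAUGE COVARIANCE OF THE OPERATOR**: `M_{U^g} = D_g M_U D_g^*` for unitary-valued `g`. [cite: Balaban1985BackgroundPropagators, p.398 l.1–2] -/
theorem covLapF_kingGaugeAct (c m2 : ℝ) {g : Tor K → Matrix n n 𝕜} (hg : ∀ x, g x ∈ Matrix.unitaryGroup n 𝕜)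
    (U : Tor K × Fin (d + 1) → Matrix n n 𝕜) :
    covLapF K c m2 (kingGaugeAct K g U) = kingGaugeMat K g * covLapF K c m2 U * (kingGaugeMat K g)ᴴ := by
  refine ext_of_blk K fun x y => ?_
  rw [blk_kingGaugeMat_conj, blk_covLapF, blk_covLapF, mul_sub, sub_mul, Matrix.mul_smul, Matrix.smul_mul,
    Finset.mul_sum, Finset.sum_mul]
  have hgg : ∀ z, g z * (g z)ᴴ = 1 := fun z => by
    simpa only [star_eq_conjTranspose] using Matrix.mem_unitaryGroup_iff.mp (hg z)
  congr 1
  · by_cases hxy : x = y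
    · subst hxy; simp only [if_true, Matrix.mul_smul, Matrix.smul_mul, Matrix.mul_one, hgg]
    · simp [hxy]
  · congr 1
    refine Finset.sum_congr rfl fun μ _ => ?_
    rw [mul_add, add_mul]
    congr 1
    · by_cases h : y = x + unitVec K μ
      · subst h; simp only [if_true, kingGaugeAct, Matrix.mul_assoc]
      · simp [h]
    · by_cases h : y = x - unitVec K μ
      · subst h
        simp only [if_true, kingGaugeAct, sub_add_cancel, conjTranspose_mul, conjTranspose_conjTranspose, Matrix.mul_assoc]
      · simp [h]
/-- ★★ **GAUGE COVARIANCE OF THE COVARIANCE**: `G_{U^g} = D_g G_U D_g^*` (unitary `g`, `U`; `c ≥ 0`, `m² > 0`).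
[cite: Balaban1985BackgroundPropagators, p.398 l.1–2] -/
theorem covLapF_kingGaugeAct_inv {c m2 : ℝ} (hc : 0 ≤ c) (hm : 0 < m2) {g : Tor K → Matrix n n 𝕜} (hg : ∀ x, g x ∈ Matrix.unitaryGroup n 𝕜)
    {U : Tor K × Fin (d + 1) → Matrix n n 𝕜} (hU : ∀ b, U b ∈ Matrix.unitaryGroup n 𝕜) :
    (covLapF K c m2 (kingGaugeAct K g U))⁻¹ = kingGaugeMat K g * (covLapF K c m2 U)⁻¹ * (kingGaugeMat K g)ᴴ := by
  refine Matrix.inv_eq_left_inv ?_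
  rw [covLapF_kingGaugeAct K c m2 hg U]
  calc kingGaugeMat K g * (covLapF K c m2 U)⁻¹ * (kingGaugeMat K g)ᴴ * (kingGaugeMat K g * covLapF K c m2 U * (kingGaugeMat K g)ᴴ)
        = kingGaugeMat K g * (covLapF K c m2 U)⁻¹ * ((kingGaugeMat K g)ᴴ * kingGaugeMat K g) * covLapF K c m2 U * (kingGaugeMat K g)ᴴ := by
          simp only [Matrix.mul_assoc]
    _ = 1 := by
          rw [kingGaugeMat_conjTranspose_mul_self K hg, Matrix.mul_one, Matrix.mul_assoc (kingGaugeMat K g), covLapF_inv_mul K hc hm hU, Matrix.mul_one,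
            kingGaugeMat_mul_conjTranspose_self K hg]
/-- ★ The BLOCKS transform by conjugation: `(G_{U^g})_{xy} = g(x)·(G_U)_{xy}·g(y)^*` — so every unitarily invariant size of a block (operator norm, singular values) is
GAUGE INVARIANT. [cite: Balaban1985BackgroundPropagators, p.398 l.1–2] -/
theorem blk_covLapF_kingGaugeAct_inv {c m2 : ℝ} (hc : 0 ≤ c) (hm : 0 < m2) {g : Tor K → Matrix n n 𝕜} (hg : ∀ x, g x ∈ Matrix.unitaryGroup n 𝕜)
    {U : Tor K × Fin (d + 1) → Matrix n n 𝕜} (hU : ∀ b, U b ∈ Matrix.unitaryGroup n 𝕜) (x y : Tor K) :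
    blk ((covLapF K c m2 (kingGaugeAct K g U))⁻¹) x y = g x * blk ((covLapF K c m2 U)⁻¹) x y * (g y)ᴴ := by
  rw [covLapF_kingGaugeAct_inv K hc hm hg hU, blk_kingGaugeMat_conj]
/-- ★ GAUGE INVARIANCE OF THE DETERMINANT: `det M_{U^g} = det M_U`. [cite: Balaban1985BackgroundPropagators, p.398 l.1–2] -/
theorem det_covLapF_kingGaugeAct (c m2 : ℝ) {g : Tor K → Matrix n n 𝕜} (hg : ∀ x, g x ∈ Matrix.unitaryGroup n 𝕜)
    (U : Tor K × Fin (d + 1) → Matrix n n 𝕜) :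
    (covLapF K c m2 (kingGaugeAct K g U)).det = (covLapF K c m2 U).det := by
  rw [covLapF_kingGaugeAct K c m2 hg U, det_mul, det_mul, mul_comm ((kingGaugeMat K g).det), mul_assoc, ← det_mul,
    kingGaugeMat_mul_conjTranspose_self K hg, det_one, mul_one]

end Gauge

end Summit.QuantumFields.YangMills.BalabanUVNodes.N15KingModelRung.Covariant

end
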